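import Literature.AlgebraicGeometry.Frobenioids.ArithmeticDivisorsPrimes
import Literature.AlgebraicGeometry.Frobenioids.ArithmeticFrobenioidHypotheses
import Literature.AlgebraicGeometry.Frobenioids.PerfectionPrimes
import Mathlib.Analysis.SpecialFunctions.Exp
import HarnessLib

/-!
# Frobenioids I, Theorem 6.4 (iii), first step: a monoid isomorphism `Φ₁^pf(L₁) ⥲ Φ₂^pf(L₂)` induces a
# bijection `V(L₁) ⥲ V(L₂)` carrying archimedean places to archimedean places — PROOFS

Mochizuki, *The geometry of Frobenioids I: the general theory*, Kyushu J. Math. **62** (2008) 293–400, Thm. 6.4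
(iii), kurims p. 115 l. 3–8: "the bijection between primes of the monoids `Φ₁`, `Φ₂` arising from the divisors
of Frobenius-trivial objects `A₁ ∈ Ob((C₁^pf)^un-tr)`; `A₂ := Ψ(A₁) ∈ Ob((C₂^pf)^un-tr)` that lie over `Spec(L₁)`,
`Spec(L₂)` … [cf. (i); Corollary 4.11, (iii)] induces a bijection between the set of valuations `V(L₁)`, `V(L₂)`
… that maps a valuation lying over a valuation `v₀` of `ℚ` to a valuation lying over the same `v₀`", for
`v₀ = ∞` (archimedean ↔ archimedean); Ex. 6.3 p. 113 ("`Prime(Φ(L)) ≃ V(L)`", "`≅ ℤ_{≥0}` if `v` is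
nonarchimedean … `≅ ℝ_{≥0}` if `v` is archimedean"). [cite: MochizukiFrdI2008, Thm. 6.4 (iii) p.115]

PROOF-ONLY (theorems, no `def`; cell abc-iut, seat abc-iut-L6-t10 gen 3, holder of the [FrdI] §6 sub-DAG
`SUBDAG-FrdI-Thm64.md`, rows T64iii/L01–L02: the glue from the MONOID isomorphism `Φ₁^pf(L₁) ⥲ Φ₂^pf(L₂)` of
Cor. 4.11 (iii) for `(Ψ^pf)^un-tr` to THE bijection of places `placeMap` of seat abc-iut-L1-t3's schema
`Thm64iii` and its archimedean clause; the residue-characteristic clause is the numeric core T64iii/L06 of seat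
abc-iut-L1-t1 and needs the realified degree, not typed here).  Over seat abc-iut-L1-t3's `EffArithDivisor.single`
/ `Ex63_primes` (seat abc-iut-L6-t10 gen 0's `isPrimary_single`, `precsim_iff_psupp_subset`) and the §0
perfection-of-primes API (`Primes.perfectionEquiv`, `Primes.congr`, seat abc-iut-L1-t2/L1-d2):
* `EffArithDivisor.isPrimary_of_single` / `pfPrimeOf_bijective` — `v ↦ [δ_v]` is a bijection
  `V(L) → Prime(Φ(L)^pf)` (Ex. 6.3 + `Prime(M) ≅ Prime(M^pf)`);
* `mk_mem_carrier_pfPrimeOf_iff` — the primary elements of the class of `v` are the `D^{1/n}` with `D`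
  supported exactly at `v`;
* `carrier_pfPrimeOf_countable_iff` — **the class of `v` is COUNTABLE iff `v` is nonarchimedean** (at a finite
  place the primary elements are the `(k · v)^{1/n}`, `k, n ≥ 1`; at an infinite place they include the
  uncountably many `t · v`, `t ∈ ℝ_{>0}`) — an intrinsic form of print's "`≅ ℤ_{≥0}` … `≅ ℝ_{≥0}`";
* **`exists_placesEquiv_of_mulEquiv`** — a monoid isomorphism `e : Φ(L₁)^pf ⥲ Φ(L₂)^pf` induces a bijection
  `π : V(L₁) ≃ V(L₂)` with `e[δ_v] = [δ_{π v}]`, carrying archimedean places to archimedean places and finite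
  places to finite places (`Primes.congr e` preserves the cardinality of the classes).

Standard axioms only. Nothing here bears on [IUTchIII] Cor. 3.12 or asserts anything about abc.
-/

noncomputable section

namespace Literature.AlgebraicGeometry.Frobenioids

open Function NumberField

namespace EffArithDivisor

variable (L : Type) [Field L] [NumberField L]

/-! ### The primes of `Φ(L)^pf` -/

/-- `Φ(L)` is sharp (it is divisorial). [cite: MochizukiFrdI2008, Ex. 6.3 p.113] -/
theorem isSharp : IsSharp (Multiplicative (EffArithDivisor L)) := (EffArithDivisor.isDivisorial L).isSharp

/-- `δ_v ∈ Φ(L)^pf` is primary. [cite: MochizukiFrdI2008, Ex. 6.3 p.113] -/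
theorem isPrimary_of_single (v : Places L) :
    IsPrimary (Perfection.of _ (Multiplicative.ofAdd (EffArithDivisor.single L v))) :=
  (Perfection.isPrimary_of_iff (isSharp L)).mpr (isPrimary_single v)

/-- **`V(L) ≃ Prime(Φ(L)^pf)`**, `v ↦ [δ_v]`: a bijection (Ex. 6.3's `Prime(Φ(L)) ≃ V(L)` followed by
`Prime(Φ(L)) ≅ Prime(Φ(L)^pf)`, §0 p. 12). [cite: MochizukiFrdI2008, Ex. 6.3 p.113] -/
theorem pfPrimeOf_bijective :
    Bijective fun v : Places L =>
      (Quotient.mk (primarySetoid _) ⟨_, isPrimary_of_single L v⟩ :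
        Primes (Perfection (Multiplicative (EffArithDivisor L)))) := by
  obtain ⟨h, hbij⟩ := Ex63_primes_holds L
  have hcomp : (fun v : Places L =>
      (Quotient.mk (primarySetoid _) ⟨_, isPrimary_of_single L v⟩ :
        Primes (Perfection (Multiplicative (EffArithDivisor L))))) =
      Primes.perfectionEquiv (isSharp L) ∘ fun v : Places L =>
        (Quotient.mk (primarySetoid _) ⟨_, h v⟩ : Primes (Multiplicative (EffArithDivisor L))) := by
    funext v
    exact (Primes.perfectionEquiv_mk (isSharp L) _ (h v) (isPrimary_of_single L v)).symm
  rw [hcomp]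
  exact (Primes.perfectionEquiv (isSharp L)).bijective.comp hbij

/-- The primary elements in the class of `v`: the `D^{1/n}` with `D` supported exactly at `v`.
[cite: MochizukiFrdI2008, Ex. 6.3 p.113] -/
theorem mk_mem_carrier_pfPrimeOf_iff (v : Places L) (D : EffArithDivisor L) (n : ℕ+) :
    Perfection.mk (Multiplicative.ofAdd D) n ∈
        Primes.carrier (Quotient.mk (primarySetoid (Perfection (Multiplicative (EffArithDivisor L))))
          ⟨_, isPrimary_of_single L v⟩) ↔
      psupp D = {v} := by
  rw [← Primes.perfectionEquiv_mk (isSharp L) _ (isPrimary_single v) (isPrimary_of_single L v),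
    Primes.mk_mem_carrier_perfectionEquiv_iff]
  constructor
  · rintro ⟨hD, hcls⟩
    obtain ⟨p, hp⟩ := isPrimary_iff.mp hD
    have hle : Precsim (Multiplicative.ofAdd D) (Multiplicative.ofAdd (EffArithDivisor.single L v)) :=
      Quotient.exact hcls
    rw [precsim_iff_psupp_subset, psupp_single, hp, Set.singleton_subset_iff, Set.mem_singleton_iff] at hle
    rw [hp, hle]
  · intro hD
    refine ⟨isPrimary_iff.mpr ⟨v, hD⟩, Quotient.sound ?_⟩
    change Precsim (Multiplicative.ofAdd D) (Multiplicative.ofAdd (EffArithDivisor.single L v))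
    rw [precsim_iff_psupp_subset, psupp_single, hD]

/-! ### The class of `v` is countable iff `v` is nonarchimedean -/

/-- An effective divisor supported exactly at the finite place `w` is `k · w` with `k = D_w`.
[cite: MochizukiFrdI2008, Ex. 6.3 p.113] -/
theorem eq_of_psupp_eq_inr {D : EffArithDivisor L} {w : FinitePlace L} (h : psupp D = {Sum.inr w}) :
    D = (Finsupp.single w (D.1 w), 0) := by
  refine Prod.ext (Finsupp.ext fun v => ?_) (funext fun w' => ?_)
  · by_cases hv : v = w
    · subst hv; simp
    · rw [Finsupp.single_eq_of_ne hv]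
      by_contra hne
      have : (Sum.inr v : Places L) ∈ psupp D := inr_mem_psupp.mpr hne
      rw [h, Set.mem_singleton_iff] at this
      exact hv (Sum.inr_injective this)
  · by_contra hne
    have : (Sum.inl w' : Places L) ∈ psupp D := inl_mem_psupp.mpr hne
    rw [h, Set.mem_singleton_iff] at this
    exact Sum.inl_ne_inr this

/-- **At a finite place the class is countable**: its elements are among the `(k · w)^{1/n}`.
[cite: MochizukiFrdI2008, Ex. 6.3 p.113] -/
theorem carrier_pfPrimeOf_inr_countable (w : FinitePlace L) :
    (Primes.carrier (Quotient.mk (primarySetoid (Perfection (Multiplicative (EffArithDivisor L))))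
        ⟨_, isPrimary_of_single L (Sum.inr w)⟩)).Countable := by
  refine (Set.countable_range fun kn : ℕ × ℕ+ =>
    Perfection.mk (Multiplicative.ofAdd ((Finsupp.single w kn.1, 0) : EffArithDivisor L)) kn.2).mono ?_
  intro x hx
  obtain ⟨⟨a, n⟩, rfl⟩ := Perfection.mk_surjective x
  have hx' : Perfection.mk (Multiplicative.ofAdd (Multiplicative.toAdd a)) n ∈ _ := hx
  rw [mk_mem_carrier_pfPrimeOf_iff] at hx'
  refine ⟨⟨(Multiplicative.toAdd a).1 w, n⟩, ?_⟩
  change Perfection.mk (Multiplicative.ofAdd ((Finsupp.single w ((Multiplicative.toAdd a).1 w), 0) : EffArithDivisor L)) n =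
    Perfection.mk a n
  rw [← eq_of_psupp_eq_inr L hx', ofAdd_toAdd]

/-- The effective divisor `t · w` at an archimedean place `w` (`t ∈ ℝ_{≥0}`).
[cite: MochizukiFrdI2008, Ex. 6.3 p.113] -/
theorem psupp_archSingle (w : InfinitePlace L) (t : NNReal) (ht : t ≠ 0) :
    psupp ((0, fun w' => by classical exact if w' = w then t else 0) : EffArithDivisor L) = {Sum.inl w} := by
  classical
  ext p
  rcases p with w' | v
  · simp only [inl_mem_psupp, Set.mem_singleton_iff, ne_eq, ite_eq_right_iff, Classical.not_imp]
    constructor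
    · rintro ⟨h, -⟩; rw [h]
    · intro h; exact ⟨Sum.inl_injective h, ht⟩
  · simp only [inr_mem_psupp, Set.mem_singleton_iff, Finsupp.coe_zero, Pi.zero_apply, ne_eq, not_true_eq_false,
      reduceCtorEq]

/-- **At an archimedean place the class is UNCOUNTABLE**: `t ↦ t · w`, `t ∈ ℝ_{>0}`, is injective into it
(`Φ(L) → Φ(L)^pf` is injective: `Φ(L)` sharp, integral, saturated), and `ℝ_{>0}` is uncountable.
[cite: MochizukiFrdI2008, Ex. 6.3 p.113] -/
theorem carrier_pfPrimeOf_inl_not_countable (w : InfinitePlace L) :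
    ¬ (Primes.carrier (Quotient.mk (primarySetoid (Perfection (Multiplicative (EffArithDivisor L))))
        ⟨_, isPrimary_of_single L (Sum.inl w)⟩)).Countable := by
  classical
  intro hc
  have hdiv := EffArithDivisor.isDivisorial L
  -- `x ↦ (exp x) · w`, `ℝ → class of w`, is injective
  let f : ℝ → Perfection (Multiplicative (EffArithDivisor L)) := fun x =>
    Perfection.mk (Multiplicative.ofAdd ((0, fun w' => if w' = w then ⟨Real.exp x, (Real.exp_pos x).le⟩ else 0) :
      EffArithDivisor L)) 1
  have hf_mem : ∀ x, f x ∈ Primes.carrier (Quotient.mk (primarySetoid (Perfection (Multiplicative (EffArithDivisor L))))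
        ⟨_, isPrimary_of_single L (Sum.inl w)⟩) := fun x => by
    change Perfection.mk _ 1 ∈ _
    rw [mk_mem_carrier_pfPrimeOf_iff]
    exact psupp_archSingle L w _ (by
      intro h
      have := congrArg (fun t : NNReal => (t : ℝ)) h
      exact (Real.exp_pos x).ne' this)
  have hf_inj : Injective f := by
    intro x y hxy
    have h1 := of_injective_of_isSharp_isIntegral_isSaturated hdiv.isSharp hdiv.isPreDivisorial.isIntegral
      hdiv.isPreDivisorial.isSaturated hxy
    have h2 := congrFun (congrArg Prod.snd (Multiplicative.ofAdd.injective h1)) w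
    simp only [if_true] at h2
    exact Real.exp_injective (congrArg (fun t : NNReal => (t : ℝ)) h2)
  haveI : Countable (Primes.carrier (Quotient.mk (primarySetoid (Perfection (Multiplicative (EffArithDivisor L))))
        ⟨_, isPrimary_of_single L (Sum.inl w)⟩)) := hc.to_subtype
  have : Countable ℝ :=
    (show Injective (fun x => (⟨f x, hf_mem x⟩ : Primes.carrier (Quotient.mk
        (primarySetoid (Perfection (Multiplicative (EffArithDivisor L)))) ⟨_, isPrimary_of_single L (Sum.inl w)⟩)))
      from fun x y h => hf_inj (congrArg Subtype.val h)).countable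
  exact not_countable_real this
where
  /-- `ℝ` is not countable. -/
  not_countable_real : ¬ Countable ℝ := fun h => by
    haveI := h
    exact Cardinal.not_countable_real Set.countable_univ

/-- **The class of `v` is countable iff `v` is nonarchimedean** — the intrinsic form of "`≅ ℤ_{≥0}` if `v` is
nonarchimedean, `≅ ℝ_{≥0}` if `v` is archimedean" (Ex. 6.3 p. 112) on the perfection.
[cite: MochizukiFrdI2008, Ex. 6.3 p.112] -/
theorem carrier_pfPrimeOf_countable_iff (v : Places L) :
    (Primes.carrier (Quotient.mk (primarySetoid (Perfection (Multiplicative (EffArithDivisor L))))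
        ⟨_, isPrimary_of_single L v⟩)).Countable ↔ ∃ w, v = Sum.inr w := by
  rcases v with w | w
  · exact ⟨fun h => absurd h (carrier_pfPrimeOf_inl_not_countable L w), fun ⟨_, h⟩ => absurd h Sum.inl_ne_inr⟩
  · exact ⟨fun _ => ⟨w, rfl⟩, fun _ => carrier_pfPrimeOf_inr_countable L w⟩

end EffArithDivisor

/-! ### A monoid isomorphism of perfections induces a type-preserving bijection of places -/

section Transport

variable (L₁ : Type) [Field L₁] [NumberField L₁] (L₂ : Type) [Field L₂] [NumberField L₂]

/-- **Thm. 6.4 (iii), first step**: a monoid isomorphism `e : Φ(L₁)^pf ⥲ Φ(L₂)^pf` (the divisor-monoid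
isomorphism of Cor. 4.11 (iii) for `(Ψ^pf)^un-tr` at Frobenius-trivial objects over `Spec L₁`, `Spec L₂`)
induces a bijection `π : V(L₁) ≃ V(L₂)` with `e[δ_v] = [δ_{π v}]` which carries ARCHIMEDEAN places to archimedean
places and finite places to finite places ("a valuation lying over `v₀` of `ℚ` to a valuation lying over the same
`v₀`" for `v₀ = ∞`; the finite `v₀` need the realified degree, row T64iii/L06). [cite: MochizukiFrdI2008, Thm. 6.4 (iii) p.115] -/
theorem exists_placesEquiv_of_mulEquiv
    (e : Perfection (Multiplicative (EffArithDivisor L₁)) ≃* Perfection (Multiplicative (EffArithDivisor L₂))) :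
    ∃ π : Places L₁ ≃ Places L₂,
      (∀ v : Places L₁,
          Primes.congr e (Quotient.mk (primarySetoid _) ⟨_, EffArithDivisor.isPrimary_of_single L₁ v⟩) =
            Quotient.mk (primarySetoid _) ⟨_, EffArithDivisor.isPrimary_of_single L₂ (π v)⟩) ∧
        (∀ w : InfinitePlace L₁, ∃ w' : InfinitePlace L₂, π (Sum.inl w) = Sum.inl w') ∧
          ∀ w : FinitePlace L₁, ∃ w' : FinitePlace L₂, π (Sum.inr w) = Sum.inr w' := by
  let p₁ := Equiv.ofBijective _ (EffArithDivisor.pfPrimeOf_bijective L₁)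
  let p₂ := Equiv.ofBijective _ (EffArithDivisor.pfPrimeOf_bijective L₂)
  let π : Places L₁ ≃ Places L₂ := p₁.trans ((Primes.congr e).trans p₂.symm)
  have hπ : ∀ v, Primes.congr e (p₁ v) = p₂ (π v) := fun v => by
    change Primes.congr e (p₁ v) = p₂ (p₂.symm (Primes.congr e (p₁ v)))
    rw [Equiv.apply_symm_apply]
  -- `Primes.congr e` preserves countability of the classes, hence the type of the place
  have hcount : ∀ v, (Primes.carrier (p₁ v)).Countable ↔ (Primes.carrier (p₂ (π v))).Countable := fun v => by
    rw [← hπ, Primes.carrier_congr]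
    constructor
    · exact fun h => h.image _
    · intro h
      have h' := h.image e.symm
      rw [Set.image_image] at h'
      refine h'.mono fun x hx => ?_
      exact ⟨x, hx, e.symm_apply_apply x⟩
  have htype : ∀ v, (∃ w, v = Sum.inr w) ↔ ∃ w', π v = Sum.inr w' := fun v => by
    rw [← EffArithDivisor.carrier_pfPrimeOf_countable_iff, ← EffArithDivisor.carrier_pfPrimeOf_countable_iff]
    exact hcount v
  refine ⟨π, hπ, fun w => ?_, fun w => (htype _).mp ⟨w, rfl⟩⟩
  rcases hπv : π (Sum.inl w) with w' | w'
  · exact ⟨w', rfl⟩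
  · exact absurd ((htype (Sum.inl w)).mpr ⟨w', hπv⟩) fun ⟨_, h⟩ => Sum.inl_ne_inr h

end Transport

end Literature.AlgebraicGeometry.Frobenioids

end
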